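import Literature.MathematicalPhysics.QuantumFieldTheory.Balaban1983to89.B3Op116FaceSumsBorderline

/-!
# `Balaban1983to89.B3Op116FaceSumsSubOne` — T. Bałaban, *(Higgs)₂,₃ quantum fields in a finite volume. III. Renormalization*,
# Commun. Math. Phys. **88** (1983) 411–445 [Balaban1983Higgs3], (1.16) p. 414 / (2.6), (2.10)–(2.11) pp. 424–426 / p. 433:
# **THE FACE CONVOLUTION WITH A FIRST EXPONENT `r ≤ 1` UNDER THE MARGIN** — a single layer on a face of a box read directly through a column of
# exponent `r ∈ (0,1]` (a differentiated column `r = 1`, a HÖLDER-transported differentiated column `r = 1 − α`) anchored one top block inside: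
# the weighted height sum `W_r(h) = Σ_{i<k}(L^iε)^{r−1}e^{−(δ/2d)h/L^i} ≤ (θL^kε)^{r−1}·(1 + 4d/δ)·r₁/(1−r₁)` and the resulting majorant of exponent
# `r + s − 1` — file 4 of the face-sheet engine; the end-point lemma of the Hölder member of the (1.16)-on-a-box programme

statement-level skeleton of published theorems with citation tags; proofs where landed; nothing here is a claim about the Yang–Mills mass gap

PDF held: `paper:balaban1983-higgs-2-3-quantum-fields-finite-volume` p. 414 [PDF 4], p. 424 [14], p. 426 [16], p. 433 [23].

CITATION HEADER (lean-in-tree rule).  T. Bałaban, CMP **88** (1983) 411–445 [Balaban1983Higgs3]: (1.16) p. 414, (2.5)/(2.6) p. 424, (2.10)–(2.11)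
p. 426, p. 433.  Cell `lit-balaban` (HOME `run/shared/lean/pub/lit-balaban/`), Phase-2 proof seat **p35** gen 27 (literature-prover-lit-balaban-p35-g27-0;
free-target protocol G.5-34(d), TAKING HOME/STATUS.md 2026-08-23T16:58:04Z + addendum, cc p40 / r15 / r14 / p33).  SKELETON rows **B3.Eq1.16** /
**B3.Eq2.5** / **B3.Txt@433** / **B3.Prop1** (owner r15) — LOCATED ENGINE FILE, no head claim: file 4 of the face-sheet engine (`B3Op116SliceSums`,
`B3Op116FaceSums`, `B3Op116FaceSumsBorderline`) of the «(2.5) for (1.16) on a cell-product box without the support clause» programme (GAPS.md G-B3-16.A1,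
route γ′; p35 `DESIGN-FILE4.md` §14 (d): *«Hölder end: hcol (exponent 1−α) likewise, W_α(h) = Σ_i ℓ_i^{−α}e^{−δ′h/ℓ_i} ≈ h^{−α} ⇒ the binder's
(ℓ_k^α)⁻¹·(h/ℓ_k)^{−α}: O(1) iff h ≳ ℓ_k»*).  USED BY NAME, never restated: p35 g26's `B3Op116SliceSums.{face_conv2_le, face_conv2_le',
face_pair_scale_algebra}`, `B3Op116FaceSumsBorderline.heightSum_le_of_height`, p33's `B3Op116MajorantConvolution.{sum_sq_le_lower_add_upper,
sum_range_succ_mesh_rpow_le}`, r14's `B3Op116ScaleChains.mesh_rpow_add`.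

WHAT IS PRINTED (verbatim).  p. 414 [PDF 4]: *"the Hölder norms of the covariant derivatives of this kernel … are exponentially decaying with the
distance of the arguments and are uniformly bounded by O(1)(e(L^kε)^{1−α})^{n+n′}, where α > 0 but can be arbitrarily small"*; p. 426 (2.11) and
*"This applies also to Hölder norms"* (the Hölder member of the propagator estimates, exponent `1 − α` in the cell's majorant currency); p. 433 [PDF 23]:
*"we take a cube □ of size 3r(L^kε) and with □₁ in the center"* — the differentiated / Hölder ends of the (1.16) kernels are read inside `□₁`.

WHAT THIS FILE PROVES (pure lattice-sum lemmas on `T_ε`; `F ⊆ {u : u_ν = c}`, anchor `b` at height `h = min{(b_ν − c) mod, (c − b_ν) mod} ≥ θL^k`).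
* §1 `one_add_mul_exp_le` (`(1+t)e^{−ct} ≤ (1 + 2/c)e^{−(c/2)t}`) and **`weightedHeightSum_le_of_height`**:
  `W_r(h) := Σ_{i<k}(L^iε)^{r−1}e^{−(δ/(2d))(L^iε)^{−1}ε·h} ≤ (θ·L^kε)^{r−1}·(1 + 4d/δ)·r₁/(1 − r₁)`, `r₁ = e^{−(δ/2)θ(L−1)/(2d)}`, for `0 < r ≤ 1`,
  `h ≥ θL^k` — UNIFORM IN `k` (`(L^iε)^{r−1} = (hε)^{r−1}(h/L^i)^{1−r}`, the polynomial weight absorbed by half the decay, then `heightSum_le_of_height`).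
* §2 **`face_conv_majorant_le_one_margin_le`**: for `0 < r ≤ 1 < s`, `0 < δ ≤ 1`, `L > 1`, height `≥ θL^k`:
  `Σ_{u∈F} 𝔪(c₁,r;δ)(b,u)·𝔪(c₂,s;δ)(u,y) ≤ 𝔪(c₁c₂(8d/δ)^{d−1}(ε^{d−1})^{−1}·(θ^{r−1}(1+4d/δ)r₁/(1−r₁) + L^{s−1}(L^{s−1}−1)^{−1}), r+s−1; δ/2)(b,y)` — the
  pairs with the exponent-`r` factor the finer carry `(L^iε)^{r−1}` and the height decay (`face_conv2_le`), summed by §1 and absorbed into the coarser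
  scale (`(L^kε)^{r−1} ≤ (L^jε)^{r−1}`); the other pairs are geometric (`s − 1 > 0`).  At `r = 1` this is `B3Op116FaceSumsBorderline.face_sum_kernel_one_margin_le`
  up to the constant; at `r = 1 − α` it is the Hölder end: `(L^kε)^{−α}` times an `O(1)` majorant of exponent `s − α`... carried as exponent `r + s − 1`.
* §3 **`face_sum_kernel_le_one_margin_le`**: the kernel form (`K ≤ 𝔪(c₁,r)(b,·)`, `S ≤ 𝔪(c₂,s)(·,y)` on `F` ⇒ `Σ_{u∈F}K(u)S(u) ≤ 𝔪(…, r+s−1; δ/2)(b,y)`).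
HONEST SCOPE.  No (1.16) object here; the use (the Hölder-transported end of the box programme, two anchors each at height `≥ θL^k`) is the sequel.
Theorems only: no `def`, no `def … : Prop`, no `sorry`; axioms standard.  Value = located engine lemma — NOT summit progress, nothing about the mass gap.
-/

noncomputable section

open scoped BigOperators

namespace Literature.MathematicalPhysics.QuantumFieldTheory.Balaban1983to89.B3Op116FaceSumsSubOne

open B3Op116ScaleChains (rate_eq mesh_rpow_add)
open B3Op116MajorantConvolution (sum_sq_le_lower_add_upper sum_range_succ_mesh_rpow_le)
open B3Op116SliceSums (face_conv2_le face_conv2_le' face_pair_scale_algebra)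
open B3Op116FaceSumsBorderline (heightSum_le_of_height)

variable {P : HiggsLattice.Params}

/-! ## §1 The weighted height sum under the margin -/

section Height

/-- `(1 + t)e^{−ct} ≤ (1 + 2/c)e^{−(c/2)t}` for `t ≥ 0`, `c > 0` (`(c/2)t ≤ e^{(c/2)t}`). [cite: Balaban1983Higgs3, (2.11) p.426] -/
theorem one_add_mul_exp_le {t c : ℝ} (ht : 0 ≤ t) (hc : 0 < c) :
    (1 + t) * Real.exp (-(c * t)) ≤ (1 + 2 / c) * Real.exp (-(c / 2 * t)) := by
  have hE : Real.exp (-(c * t)) = Real.exp (-(c / 2 * t)) * Real.exp (-(c / 2 * t)) := by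
    rw [← Real.exp_add]; ring_nf
  have hE0 : 0 ≤ Real.exp (-(c / 2 * t)) := Real.exp_nonneg _
  have hE1 : Real.exp (-(c / 2 * t)) ≤ 1 := Real.exp_le_one_iff.mpr (by nlinarith)
  -- `t·e^{−(c/2)t} ≤ 2/c`
  have hlin : c / 2 * t ≤ Real.exp (c / 2 * t) := by
    have := Real.add_one_le_exp (c / 2 * t); linarith
  have ht2 : t * Real.exp (-(c / 2 * t)) ≤ 2 / c := by
    rw [Real.exp_neg, ← div_eq_mul_inv, div_le_div_iff₀ (Real.exp_pos _) hc]
    nlinarith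
  rw [hE]
  have h1 : (1 + t) * (Real.exp (-(c / 2 * t)) * Real.exp (-(c / 2 * t)))
      = (Real.exp (-(c / 2 * t)) + t * Real.exp (-(c / 2 * t))) * Real.exp (-(c / 2 * t)) := by ring
  rw [h1]
  exact mul_le_mul_of_nonneg_right (add_le_add hE1 ht2) hE0

/-- **THE WEIGHTED HEIGHT SUM IS `O((θL^kε)^{r−1})` AT HEIGHTS OF ONE TOP BLOCK**: for `0 < r ≤ 1`, `δ, θ > 0`, `L > 1` and `h ≥ θ·L^k`,
`Σ_{i<k}(L^iε)^{r−1}·e^{−(δ/(2d))(L^iε)^{−1}ε·h} ≤ (θ·L^kε)^{r−1}·(1 + 4d/δ)·r₁/(1 − r₁)`, `r₁ = e^{−(δ/2)θ(L−1)/(2d)}` — uniform in `k`; at `r = 1 − α`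
this is the `(L^kε)^{−α}·θ^{−α}·O(1)` of p35 `DESIGN-FILE4.md` §14 (d). [cite: Balaban1983Higgs3, (1.16) p.414, (2.6) p.424, (2.11) p.426, p.433] -/
theorem weightedHeightSum_le_of_height (hL : 1 < P.L) (k : ℕ) {δ θ h r : ℝ} (hδ : 0 < δ) (hθ : 0 < θ) (hr0 : 0 < r) (hr1 : r ≤ 1)
    (hh : θ * (P.L : ℝ) ^ k ≤ h) :
    ∑ i ∈ Finset.range k, P.mesh i ^ (r - 1) * Real.exp (-(δ / (2 * P.d) * (P.mesh i)⁻¹ * (P.mesh 0 * h)))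
      ≤ (θ * P.mesh k) ^ (r - 1) * ((1 + 4 * P.d / δ) *
          (Real.exp (-(δ / 2 * θ * ((P.L : ℝ) - 1) / (2 * P.d))) / (1 - Real.exp (-(δ / 2 * θ * ((P.L : ℝ) - 1) / (2 * P.d)))))) := by
  have hd0 : (0 : ℝ) < P.d := by exact_mod_cast P.hd
  have hε : 0 < P.mesh 0 := P.mesh_pos 0
  have hm : ∀ j, 0 < P.mesh j := P.mesh_pos
  have hLk : (0 : ℝ) < (P.L : ℝ) ^ k := by have := P.hL; positivity
  have hh0 : 0 < h := lt_of_lt_of_le (mul_pos hθ hLk) hh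
  set c : ℝ := δ / (2 * P.d) with hc
  have hc0 : 0 < c := by rw [hc]; positivity
  have hc2 : 1 + 2 / c = 1 + 4 * P.d / δ := by rw [hc]; field_simp; ring
  -- termwise: `(L^iε)^{r−1}e^{−c h/L^i} ≤ (hε)^{r−1}(1+2/c)e^{−(c/2)h/L^i}`
  have hterm : ∀ i ∈ Finset.range k,
      P.mesh i ^ (r - 1) * Real.exp (-(δ / (2 * P.d) * (P.mesh i)⁻¹ * (P.mesh 0 * h)))
        ≤ (P.mesh 0 * h) ^ (r - 1) * ((1 + 2 / c) * Real.exp (-(δ / 2 / (2 * P.d) * (P.mesh i)⁻¹ * (P.mesh 0 * h)))) := by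
    intro i _
    -- `t = εh/(L^iε) = h/L^i > 0`
    set t : ℝ := (P.mesh i)⁻¹ * (P.mesh 0 * h) with ht
    have ht0 : 0 < t := by rw [ht]; exact mul_pos (inv_pos.mpr (hm i)) (mul_pos hε hh0)
    have hmesh : P.mesh i = P.mesh 0 * h / t := by
      rw [ht]; field_simp
    have hpow : P.mesh i ^ (r - 1) = (P.mesh 0 * h) ^ (r - 1) * t ^ (1 - r) := by
      rw [hmesh, Real.div_rpow (mul_pos hε hh0).le ht0.le, div_eq_mul_inv, ← Real.rpow_neg ht0.le, neg_sub]
    have e1 : -(δ / (2 * P.d) * (P.mesh i)⁻¹ * (P.mesh 0 * h)) = -(c * t) := by rw [hc, ht]; ring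
    have e2 : -(δ / 2 / (2 * P.d) * (P.mesh i)⁻¹ * (P.mesh 0 * h)) = -(c / 2 * t) := by rw [hc, ht]; ring
    rw [hpow, e1, e2, mul_assoc]
    refine mul_le_mul_of_nonneg_left ?_ (Real.rpow_nonneg (mul_pos hε hh0).le _)
    -- `t^{1−r} ≤ 1 + t` (`t ≥ 0`, `0 ≤ 1 − r ≤ 1`; the elementary fact `Literature.Analysis.PDE.rpow_le_one_add`, inlined rather than imported)
    have hrp : t ^ (1 - r) ≤ 1 + t := by
      rcases le_or_gt t 1 with h1 | h1
      · exact (Real.rpow_le_one ht0.le h1 (by linarith)).trans (by linarith)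
      · exact (Real.rpow_le_self_of_one_le h1.le (by linarith)).trans (by linarith)
    calc t ^ (1 - r) * Real.exp (-(c * t)) ≤ (1 + t) * Real.exp (-(c * t)) := mul_le_mul_of_nonneg_right hrp (Real.exp_nonneg _)
      _ ≤ (1 + 2 / c) * Real.exp (-(c / 2 * t)) := one_add_mul_exp_le ht0.le hc0
  -- the plain height sum at half the rate
  have hW := heightSum_le_of_height (P := P) hL k (δ := δ / 2) (half_pos hδ) hθ hh
  -- `(hε)^{r−1} ≤ (θL^kε)^{r−1}`
  have hanti : (P.mesh 0 * h) ^ (r - 1) ≤ (θ * P.mesh k) ^ (r - 1) := by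
    have hle : θ * P.mesh k ≤ P.mesh 0 * h := by
      have emesh : P.mesh k = (P.L : ℝ) ^ k * P.mesh 0 := by unfold HiggsLattice.Params.mesh; ring
      rw [emesh]
      nlinarith [hh, hε]
    exact Real.rpow_le_rpow_of_nonpos (mul_pos hθ (hm k)) hle (by linarith)
  have hA0 : 0 ≤ (1 + 2 / c) := by positivity
  calc ∑ i ∈ Finset.range k, P.mesh i ^ (r - 1) * Real.exp (-(δ / (2 * P.d) * (P.mesh i)⁻¹ * (P.mesh 0 * h)))
      ≤ ∑ i ∈ Finset.range k, (P.mesh 0 * h) ^ (r - 1) * ((1 + 2 / c) * Real.exp (-(δ / 2 / (2 * P.d) * (P.mesh i)⁻¹ * (P.mesh 0 * h)))) :=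
        Finset.sum_le_sum hterm
    _ = (P.mesh 0 * h) ^ (r - 1) * ((1 + 2 / c) *
          ∑ i ∈ Finset.range k, Real.exp (-(δ / 2 / (2 * P.d) * (P.mesh i)⁻¹ * (P.mesh 0 * h)))) := by
        rw [Finset.mul_sum, Finset.mul_sum]
    _ ≤ (θ * P.mesh k) ^ (r - 1) * ((1 + 2 / c) *
          (Real.exp (-(δ / 2 * θ * ((P.L : ℝ) - 1) / (2 * P.d))) / (1 - Real.exp (-(δ / 2 * θ * ((P.L : ℝ) - 1) / (2 * P.d)))))) := by
        have hS0 : 0 ≤ ∑ i ∈ Finset.range k, Real.exp (-(δ / 2 / (2 * P.d) * (P.mesh i)⁻¹ * (P.mesh 0 * h))) :=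
          Finset.sum_nonneg fun _ _ => Real.exp_nonneg _
        have hq0 : 0 ≤ Real.exp (-(δ / 2 * θ * ((P.L : ℝ) - 1) / (2 * P.d))) / (1 - Real.exp (-(δ / 2 * θ * ((P.L : ℝ) - 1) / (2 * P.d)))) :=
          hS0.trans hW
        exact mul_le_mul hanti (mul_le_mul_of_nonneg_left hW hA0) (mul_nonneg hA0 hS0) (Real.rpow_nonneg (mul_pos hθ (hm k)).le _)
    _ = _ := by rw [hc2]

end Height

/-! ## §2 The face convolution with first exponent `r ≤ 1` under the margin -/

section Face

/-- **THE FACE CONVOLUTION WITH A FIRST EXPONENT `r ∈ (0,1]` AT AN ANCHOR ONE TOP BLOCK INSIDE**: for `0 < r ≤ 1 < s`, `0 < δ ≤ 1`, `L > 1`,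
`F ⊆ {u_ν = c}`, `θ > 0` and an anchor `b` with `θL^k ≤ min{(b_ν − c) mod, (c − b_ν) mod}`:
`Σ_{u∈F} 𝔪(c₁,r;δ)(b,u)·𝔪(c₂,s;δ)(u,y) ≤ 𝔪(c₁c₂(8d/δ)^{d−1}(ε^{d−1})^{−1}(θ^{r−1}(1+4d/δ)r₁/(1−r₁) + L^{s−1}/(L^{s−1}−1)), r+s−1; δ/2)(b,y)`,
`r₁ = e^{−(δ/2)θ(L−1)/(2d)}` — UNIFORM IN `k`. [cite: Balaban1983Higgs3, (1.16) p.414, (2.6) p.424, (2.10)–(2.11) p.426, p.433] -/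
theorem face_conv_majorant_le_one_margin_le (hL : 1 < P.L) {k : ℕ} {δ : ℝ} (hδ : 0 < δ) (hδ1 : δ ≤ 1) {r s c₁ c₂ θ : ℝ}
    (hr0 : 0 < r) (hr1 : r ≤ 1) (hs : 1 < s) (hc₁ : 0 ≤ c₁) (hc₂ : 0 ≤ c₂) (hθ : 0 < θ)
    {F : Finset (HiggsLattice.Site P 0)} {ν : Fin P.d} {c : ZMod (P.sitesPerDir 0 ν)} (hF : ∀ u ∈ F, u ν = c)
    (b y : HiggsLattice.Site P 0) (hh : θ * (P.L : ℝ) ^ k ≤ ((min (b ν - c).val (c - b ν).val : ℕ) : ℝ)) :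
    ∑ u ∈ F,
        (∑ j ∈ Finset.range k, c₁ * P.mesh j ^ (r - (P.d : ℝ)) *
            Real.exp (-(δ * (P.mesh j)⁻¹ * (P.mesh 0 * (HiggsLattice.Site.tdist b u : ℝ))))) *
        (∑ j ∈ Finset.range k, c₂ * P.mesh j ^ (s - (P.d : ℝ)) *
            Real.exp (-(δ * (P.mesh j)⁻¹ * (P.mesh 0 * (HiggsLattice.Site.tdist u y : ℝ)))))
      ≤ ∑ j ∈ Finset.range k, (c₁ * c₂ * ((8 * P.d / δ) ^ (P.d - 1) * (P.mesh 0 ^ (P.d - 1))⁻¹ *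
            (θ ^ (r - 1) * ((1 + 4 * P.d / δ) *
                (Real.exp (-(δ / 2 * θ * ((P.L : ℝ) - 1) / (2 * P.d))) / (1 - Real.exp (-(δ / 2 * θ * ((P.L : ℝ) - 1) / (2 * P.d))))))
              + (P.L : ℝ) ^ (s - 1) / ((P.L : ℝ) ^ (s - 1) - 1)))) *
          P.mesh j ^ (r + s - 1 - (P.d : ℝ)) *
          Real.exp (-(δ / 2 * (P.mesh j)⁻¹ * (P.mesh 0 * (HiggsLattice.Site.tdist b y : ℝ)))) := by
  have hL1 : (1 : ℝ) < (P.L : ℝ) := by exact_mod_cast hL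
  have hL0 : (0 : ℝ) ≤ (P.L : ℝ) := Nat.cast_nonneg _
  have hm : ∀ j, 0 < P.mesh j := P.mesh_pos
  have hs' : 0 < s - 1 := by linarith
  -- abbreviations
  set E : ℕ → HiggsLattice.Site P 0 → HiggsLattice.Site P 0 → ℝ :=
    fun j u v => Real.exp (-(δ * (P.mesh j)⁻¹ * (P.mesh 0 * (HiggsLattice.Site.tdist u v : ℝ)))) with hE
  set E2 : ℕ → ℝ := fun j => Real.exp (-(δ / 2 * (P.mesh j)⁻¹ * (P.mesh 0 * (HiggsLattice.Site.tdist b y : ℝ)))) with hE2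
  have hE20 : ∀ j, 0 ≤ E2 j := fun j => Real.exp_nonneg _
  set hgt : ℝ := ((min (b ν - c).val (c - b ν).val : ℕ) : ℝ) with hhgt
  set H : ℕ → ℝ := fun i => Real.exp (-(δ / (2 * P.d) * (P.mesh i)⁻¹ * (P.mesh 0 * hgt))) with hH
  have hH0 : ∀ i, 0 ≤ H i := fun i => Real.exp_nonneg _
  have hH1 : ∀ i, H i ≤ 1 := fun i => Real.exp_le_one_iff.mpr (by
    have : 0 ≤ δ / (2 * P.d) * (P.mesh i)⁻¹ * (P.mesh 0 * hgt) := by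
      have := hm i; have := hm 0; positivity
    linarith)
  set Λ : ℝ := (1 + 4 * P.d / δ) *
      (Real.exp (-(δ / 2 * θ * ((P.L : ℝ) - 1) / (2 * P.d))) / (1 - Real.exp (-(δ / 2 * θ * ((P.L : ℝ) - 1) / (2 * P.d))))) with hΛ
  -- the weighted height sum and its bound (§1)
  set Wr : ℝ := ∑ i ∈ Finset.range k, P.mesh i ^ (r - 1) * H i with hWr
  have hWr : Wr ≤ (θ * P.mesh k) ^ (r - 1) * Λ := weightedHeightSum_le_of_height (P := P) hL k hδ hθ hr0 hr1 hh
  have hΛ0 : 0 ≤ Λ := by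
    have h0 : 0 ≤ Wr := Finset.sum_nonneg fun i _ => mul_nonneg (Real.rpow_nonneg (hm i).le _) (hH0 i)
    have h1 : 0 < (θ * P.mesh k) ^ (r - 1) := Real.rpow_pos_of_pos (mul_pos hθ (hm k)) _
    nlinarith [h0.trans hWr]
  set K₀ : ℝ := (8 * P.d / δ) ^ (P.d - 1) with hK₀
  have hK₀0 : 0 ≤ K₀ := by rw [hK₀]; positivity
  set G₂ : ℝ := (P.L : ℝ) ^ (s - 1) / ((P.L : ℝ) ^ (s - 1) - 1) with hG₂
  have hG₂0 : 0 ≤ G₂ := by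
    have := Real.one_lt_rpow hL1 hs'; rw [hG₂]; exact div_nonneg (by linarith) (by linarith)
  -- the height factor of a pair
  set Hf : ℕ → ℕ → ℝ := fun j₁ j₂ => if j₁ ≤ j₂ then H j₁ else 1 with hHf
  have hHf0 : ∀ j₁ j₂, 0 ≤ Hf j₁ j₂ := fun j₁ j₂ => by simp only [hHf]; split_ifs; exacts [hH0 _, zero_le_one]
  have hHf1 : ∀ j₁ j₂, Hf j₁ j₂ ≤ 1 := fun j₁ j₂ => by simp only [hHf]; split_ifs; exacts [hH1 _, le_rfl]
  -- the pair term after the face sum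
  set g : ℕ → ℕ → ℝ := fun j₁ j₂ =>
    P.mesh j₁ ^ r * P.mesh j₂ ^ s * (P.mesh (max j₁ j₂) ^ P.d)⁻¹ * (P.mesh (min j₁ j₂))⁻¹ * Hf j₁ j₂ * E2 (max j₁ j₂) with hg
  have hg0 : ∀ j₁ j₂, 0 ≤ g j₁ j₂ := fun j₁ j₂ => by
    rw [hg]
    exact mul_nonneg (mul_nonneg (mul_nonneg (mul_nonneg (mul_nonneg (Real.rpow_nonneg (hm j₁).le _)
      (Real.rpow_nonneg (hm j₂).le _)) (inv_nonneg.mpr (pow_nonneg (hm _).le _))) (inv_nonneg.mpr (hm _).le)) (hHf0 _ _)) (hE20 _)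
  -- Step 1: expand and bring the face sum inside
  have step1 : ∑ u ∈ F,
        (∑ j ∈ Finset.range k, c₁ * P.mesh j ^ (r - (P.d : ℝ)) * E j b u) *
        (∑ j ∈ Finset.range k, c₂ * P.mesh j ^ (s - (P.d : ℝ)) * E j u y)
      = ∑ j₁ ∈ Finset.range k, ∑ j₂ ∈ Finset.range k,
          c₁ * c₂ * (P.mesh j₁ ^ (r - (P.d : ℝ)) * P.mesh j₂ ^ (s - (P.d : ℝ))) *
            ∑ u ∈ F, E j₁ b u * E j₂ u y := by
    calc ∑ u ∈ F,
          (∑ j ∈ Finset.range k, c₁ * P.mesh j ^ (r - (P.d : ℝ)) * E j b u) *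
          (∑ j ∈ Finset.range k, c₂ * P.mesh j ^ (s - (P.d : ℝ)) * E j u y)
        = ∑ u ∈ F, ∑ j₁ ∈ Finset.range k, ∑ j₂ ∈ Finset.range k,
            c₁ * c₂ * (P.mesh j₁ ^ (r - (P.d : ℝ)) * P.mesh j₂ ^ (s - (P.d : ℝ))) * (E j₁ b u * E j₂ u y) := by
          refine Finset.sum_congr rfl fun u _ => ?_
          rw [Finset.sum_mul_sum]
          refine Finset.sum_congr rfl fun j₁ _ => Finset.sum_congr rfl fun j₂ _ => ?_
          ring
      _ = ∑ j₁ ∈ Finset.range k, ∑ u ∈ F, ∑ j₂ ∈ Finset.range k,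
            c₁ * c₂ * (P.mesh j₁ ^ (r - (P.d : ℝ)) * P.mesh j₂ ^ (s - (P.d : ℝ))) * (E j₁ b u * E j₂ u y) :=
          Finset.sum_comm
      _ = ∑ j₁ ∈ Finset.range k, ∑ j₂ ∈ Finset.range k, ∑ u ∈ F,
            c₁ * c₂ * (P.mesh j₁ ^ (r - (P.d : ℝ)) * P.mesh j₂ ^ (s - (P.d : ℝ))) * (E j₁ b u * E j₂ u y) :=
          Finset.sum_congr rfl fun j₁ _ => Finset.sum_comm
      _ = _ := by
          refine Finset.sum_congr rfl fun j₁ _ => Finset.sum_congr rfl fun j₂ _ => ?_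
          rw [Finset.mul_sum]
  -- Step 2: each pair of scales
  have step2 : ∀ j₁ j₂ : ℕ,
      c₁ * c₂ * (P.mesh j₁ ^ (r - (P.d : ℝ)) * P.mesh j₂ ^ (s - (P.d : ℝ))) * ∑ u ∈ F, E j₁ b u * E j₂ u y
        ≤ c₁ * c₂ * K₀ * (P.mesh 0 ^ (P.d - 1))⁻¹ * g j₁ j₂ := by
    intro j₁ j₂
    have hpre : 0 ≤ c₁ * c₂ * (P.mesh j₁ ^ (r - (P.d : ℝ)) * P.mesh j₂ ^ (s - (P.d : ℝ))) :=
      mul_nonneg (mul_nonneg hc₁ hc₂) (mul_nonneg (Real.rpow_nonneg (hm j₁).le _) (Real.rpow_nonneg (hm j₂).le _))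
    have hconv : ∑ u ∈ F, E j₁ b u * E j₂ u y ≤ K₀ * ((P.L : ℝ) ^ (min j₁ j₂)) ^ (P.d - 1) * Hf j₁ j₂ * E2 (max j₁ j₂) := by
      by_cases hj : j₁ ≤ j₂
      · have h := face_conv2_le (P := P) hδ hδ1 hj hF b y
        have e1 : Hf j₁ j₂ = H j₁ := by simp only [hHf, if_pos hj]
        rw [min_eq_left hj, max_eq_right hj, e1]
        exact h
      · have hj' : j₂ ≤ j₁ := le_of_not_ge hj
        have h := face_conv2_le' (P := P) hδ hδ1 hj' hF b y
        have e1 : Hf j₁ j₂ = 1 := by simp only [hHf, if_neg hj]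
        rw [min_eq_right hj', max_eq_left hj', e1, mul_one]
        refine h.trans ?_
        have hC : 0 ≤ K₀ * ((P.L : ℝ) ^ j₂) ^ (P.d - 1) := by positivity
        have hHy : Real.exp (-(δ / (2 * P.d) * (P.mesh j₂)⁻¹ *
            (P.mesh 0 * ((min (y ν - c).val (c - y ν).val : ℕ) : ℝ)))) ≤ 1 :=
          Real.exp_le_one_iff.mpr (by
            have : 0 ≤ δ / (2 * P.d) * (P.mesh j₂)⁻¹ * (P.mesh 0 * ((min (y ν - c).val (c - y ν).val : ℕ) : ℝ)) := by
              have := hm j₂; have := hm 0; positivity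
            linarith)
        calc _ ≤ K₀ * ((P.L : ℝ) ^ j₂) ^ (P.d - 1) * 1 * E2 j₁ :=
              mul_le_mul_of_nonneg_right (mul_le_mul_of_nonneg_left hHy hC) (hE20 _)
          _ = _ := by rw [mul_one]
    calc c₁ * c₂ * (P.mesh j₁ ^ (r - (P.d : ℝ)) * P.mesh j₂ ^ (s - (P.d : ℝ))) * ∑ u ∈ F, E j₁ b u * E j₂ u y
        ≤ c₁ * c₂ * (P.mesh j₁ ^ (r - (P.d : ℝ)) * P.mesh j₂ ^ (s - (P.d : ℝ))) *
            (K₀ * ((P.L : ℝ) ^ (min j₁ j₂)) ^ (P.d - 1) * Hf j₁ j₂ * E2 (max j₁ j₂)) := mul_le_mul_of_nonneg_left hconv hpre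
      _ = c₁ * c₂ * K₀ * (P.mesh j₁ ^ (r - (P.d : ℝ)) * P.mesh j₂ ^ (s - (P.d : ℝ)) * ((P.L : ℝ) ^ (min j₁ j₂)) ^ (P.d - 1)) *
            Hf j₁ j₂ * E2 (max j₁ j₂) := by ring
      _ = c₁ * c₂ * K₀ * (P.mesh j₁ ^ r * P.mesh j₂ ^ s * (P.mesh (max j₁ j₂) ^ P.d)⁻¹ * (P.mesh (min j₁ j₂))⁻¹ *
            (P.mesh 0 ^ (P.d - 1))⁻¹) * Hf j₁ j₂ * E2 (max j₁ j₂) := by rw [face_pair_scale_algebra]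
      _ = c₁ * c₂ * K₀ * (P.mesh 0 ^ (P.d - 1))⁻¹ * g j₁ j₂ := by rw [hg]; ring
  -- Step 3: the lower triangle (`j₂ ≤ j₁`): the finer index carries `s − 1 > 0`
  have step3 : ∀ j₁ : ℕ, ∑ j₂ ∈ Finset.range (j₁ + 1), g j₁ j₂ ≤ G₂ * (P.mesh j₁ ^ (r + s - 1 - (P.d : ℝ)) * E2 j₁) := by
    intro j₁
    have hmax : ∀ j₂ ∈ Finset.range (j₁ + 1), g j₁ j₂
        ≤ P.mesh j₁ ^ r * (P.mesh j₁ ^ P.d)⁻¹ * E2 j₁ * P.mesh j₂ ^ (s - 1) := by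
      intro j₂ hj₂
      have h : max j₁ j₂ = j₁ := max_eq_left (by have := Finset.mem_range.1 hj₂; omega)
      have h' : min j₁ j₂ = j₂ := min_eq_right (by have := Finset.mem_range.1 hj₂; omega)
      have e : P.mesh j₁ ^ r * P.mesh j₂ ^ s * (P.mesh j₁ ^ P.d)⁻¹ * (P.mesh j₂)⁻¹ * E2 j₁
          = P.mesh j₁ ^ r * (P.mesh j₁ ^ P.d)⁻¹ * E2 j₁ * P.mesh j₂ ^ (s - 1) := by
        rw [Real.rpow_sub_one (hm j₂).ne']; field_simp
      have hpre : 0 ≤ P.mesh j₁ ^ r * P.mesh j₂ ^ s * (P.mesh j₁ ^ P.d)⁻¹ * (P.mesh j₂)⁻¹ :=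
        mul_nonneg (mul_nonneg (mul_nonneg (Real.rpow_nonneg (hm j₁).le _) (Real.rpow_nonneg (hm j₂).le _))
          (inv_nonneg.mpr (pow_nonneg (hm _).le _))) (inv_nonneg.mpr (hm _).le)
      rw [hg]; simp only [h, h']
      calc P.mesh j₁ ^ r * P.mesh j₂ ^ s * (P.mesh j₁ ^ P.d)⁻¹ * (P.mesh j₂)⁻¹ * Hf j₁ j₂ * E2 j₁
          ≤ P.mesh j₁ ^ r * P.mesh j₂ ^ s * (P.mesh j₁ ^ P.d)⁻¹ * (P.mesh j₂)⁻¹ * 1 * E2 j₁ :=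
            mul_le_mul_of_nonneg_right (mul_le_mul_of_nonneg_left (hHf1 _ _) hpre) (hE20 _)
        _ = _ := by rw [mul_one, e]
    refine (Finset.sum_le_sum hmax).trans ?_
    rw [← Finset.mul_sum]
    have hpre : 0 ≤ P.mesh j₁ ^ r * (P.mesh j₁ ^ P.d)⁻¹ * E2 j₁ :=
      mul_nonneg (mul_nonneg (Real.rpow_nonneg (hm j₁).le _) (inv_nonneg.mpr (pow_nonneg (hm _).le _))) (hE20 _)
    calc P.mesh j₁ ^ r * (P.mesh j₁ ^ P.d)⁻¹ * E2 j₁ * ∑ j₂ ∈ Finset.range (j₁ + 1), P.mesh j₂ ^ (s - 1)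
        ≤ P.mesh j₁ ^ r * (P.mesh j₁ ^ P.d)⁻¹ * E2 j₁ * (G₂ * P.mesh j₁ ^ (s - 1)) :=
          mul_le_mul_of_nonneg_left (sum_range_succ_mesh_rpow_le hL hs' j₁) hpre
      _ = G₂ * ((P.mesh j₁ ^ r * P.mesh j₁ ^ (s - 1) * (P.mesh j₁ ^ P.d)⁻¹) * E2 j₁) := by ring
      _ = G₂ * (P.mesh j₁ ^ (r + s - 1 - (P.d : ℝ)) * E2 j₁) := by
          rw [mesh_rpow_add, Real.rpow_sub (hm j₁), Real.rpow_natCast, div_eq_mul_inv]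
          ring_nf
  -- Step 4: the upper triangle (`j₁ ≤ j₂ < k`): the weighted height sum, bounded by §1 and absorbed into the coarser scale
  have step4 : ∀ j₂ ∈ Finset.range k, ∑ j₁ ∈ Finset.range (j₂ + 1), g j₁ j₂
      ≤ θ ^ (r - 1) * Λ * (P.mesh j₂ ^ (r + s - 1 - (P.d : ℝ)) * E2 j₂) := by
    intro j₂ hj₂
    have hk : j₂ + 1 ≤ k := Finset.mem_range.1 hj₂
    have hmax : ∀ j₁ ∈ Finset.range (j₂ + 1), g j₁ j₂ = P.mesh j₂ ^ s * (P.mesh j₂ ^ P.d)⁻¹ * E2 j₂ * (P.mesh j₁ ^ (r - 1) * H j₁) := by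
      intro j₁ hj₁
      have hle : j₁ ≤ j₂ := by have := Finset.mem_range.1 hj₁; omega
      have h : max j₁ j₂ = j₂ := max_eq_right hle
      have h' : min j₁ j₂ = j₁ := min_eq_left hle
      have e1 : Hf j₁ j₂ = H j₁ := by simp only [hHf, if_pos hle]
      rw [hg]; simp only [h, h']
      rw [e1, Real.rpow_sub_one (hm j₁).ne', div_eq_mul_inv]
      ring
    rw [Finset.sum_congr rfl hmax, ← Finset.mul_sum]
    have hpre : 0 ≤ P.mesh j₂ ^ s * (P.mesh j₂ ^ P.d)⁻¹ * E2 j₂ :=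
      mul_nonneg (mul_nonneg (Real.rpow_nonneg (hm j₂).le _) (inv_nonneg.mpr (pow_nonneg (hm _).le _))) (hE20 _)
    have hsub : ∑ j₁ ∈ Finset.range (j₂ + 1), P.mesh j₁ ^ (r - 1) * H j₁ ≤ Wr :=
      Finset.sum_le_sum_of_subset_of_nonneg
        (fun i hi => Finset.mem_range.mpr (lt_of_lt_of_le (Finset.mem_range.mp hi) hk))
        (fun i _ _ => mul_nonneg (Real.rpow_nonneg (hm i).le _) (hH0 i))
    -- `(θ·L^kε)^{r−1} ≤ θ^{r−1}(L^{j₂}ε)^{r−1}`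
    have hkj : (θ * P.mesh k) ^ (r - 1) ≤ θ ^ (r - 1) * P.mesh j₂ ^ (r - 1) := by
      rw [Real.mul_rpow hθ.le (hm k).le]
      refine mul_le_mul_of_nonneg_left ?_ (Real.rpow_nonneg hθ.le _)
      have hmesh : P.mesh j₂ ≤ P.mesh k := by
        unfold HiggsLattice.Params.mesh
        exact mul_le_mul_of_nonneg_right (pow_le_pow_right₀ hL1.le (by omega : j₂ ≤ k)) P.hε.le
      exact Real.rpow_le_rpow_of_nonpos (hm j₂) hmesh (by linarith)
    have hW2 : Wr ≤ θ ^ (r - 1) * P.mesh j₂ ^ (r - 1) * Λ :=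
      hWr.trans (mul_le_mul_of_nonneg_right hkj hΛ0)
    calc P.mesh j₂ ^ s * (P.mesh j₂ ^ P.d)⁻¹ * E2 j₂ * ∑ j₁ ∈ Finset.range (j₂ + 1), P.mesh j₁ ^ (r - 1) * H j₁
        ≤ P.mesh j₂ ^ s * (P.mesh j₂ ^ P.d)⁻¹ * E2 j₂ * (θ ^ (r - 1) * P.mesh j₂ ^ (r - 1) * Λ) :=
          mul_le_mul_of_nonneg_left (hsub.trans hW2) hpre
      _ = θ ^ (r - 1) * Λ * ((P.mesh j₂ ^ (r - 1) * P.mesh j₂ ^ s * (P.mesh j₂ ^ P.d)⁻¹) * E2 j₂) := by ring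
      _ = θ ^ (r - 1) * Λ * (P.mesh j₂ ^ (r + s - 1 - (P.d : ℝ)) * E2 j₂) := by
          rw [mesh_rpow_add, Real.rpow_sub (hm j₂), Real.rpow_natCast, div_eq_mul_inv]
          ring_nf
  -- Step 5: assemble
  have hpre : 0 ≤ c₁ * c₂ * K₀ * (P.mesh 0 ^ (P.d - 1))⁻¹ :=
    mul_nonneg (mul_nonneg (mul_nonneg hc₁ hc₂) hK₀0) (inv_nonneg.mpr (pow_nonneg (hm 0).le _))
  calc ∑ u ∈ F,
        (∑ j ∈ Finset.range k, c₁ * P.mesh j ^ (r - (P.d : ℝ)) * E j b u) *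
        (∑ j ∈ Finset.range k, c₂ * P.mesh j ^ (s - (P.d : ℝ)) * E j u y)
      = _ := step1
    _ ≤ ∑ j₁ ∈ Finset.range k, ∑ j₂ ∈ Finset.range k, c₁ * c₂ * K₀ * (P.mesh 0 ^ (P.d - 1))⁻¹ * g j₁ j₂ :=
        Finset.sum_le_sum fun j₁ _ => Finset.sum_le_sum fun j₂ _ => step2 j₁ j₂
    _ = c₁ * c₂ * K₀ * (P.mesh 0 ^ (P.d - 1))⁻¹ * ∑ j₁ ∈ Finset.range k, ∑ j₂ ∈ Finset.range k, g j₁ j₂ := by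
        simp_rw [Finset.mul_sum]
    _ ≤ c₁ * c₂ * K₀ * (P.mesh 0 ^ (P.d - 1))⁻¹ *
          ((∑ j₁ ∈ Finset.range k, ∑ j₂ ∈ Finset.range (j₁ + 1), g j₁ j₂)
            + ∑ j₂ ∈ Finset.range k, ∑ j₁ ∈ Finset.range (j₂ + 1), g j₁ j₂) :=
        mul_le_mul_of_nonneg_left (sum_sq_le_lower_add_upper k g hg0) hpre
    _ ≤ c₁ * c₂ * K₀ * (P.mesh 0 ^ (P.d - 1))⁻¹ *
          ((∑ j₁ ∈ Finset.range k, G₂ * (P.mesh j₁ ^ (r + s - 1 - (P.d : ℝ)) * E2 j₁))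
            + ∑ j₂ ∈ Finset.range k, θ ^ (r - 1) * Λ * (P.mesh j₂ ^ (r + s - 1 - (P.d : ℝ)) * E2 j₂)) :=
        mul_le_mul_of_nonneg_left (add_le_add (Finset.sum_le_sum fun j₁ _ => step3 j₁)
          (Finset.sum_le_sum fun j₂ hj₂ => step4 j₂ hj₂)) hpre
    _ = ∑ j ∈ Finset.range k, (c₁ * c₂ * (K₀ * (P.mesh 0 ^ (P.d - 1))⁻¹ * (θ ^ (r - 1) * Λ + G₂))) *
          P.mesh j ^ (r + s - 1 - (P.d : ℝ)) * E2 j := by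
        rw [← Finset.sum_add_distrib, Finset.mul_sum]
        exact Finset.sum_congr rfl fun j _ => by ring
    _ = _ := by rw [hK₀, hΛ, hG₂]

end Face

/-! ## §3 The kernel form -/

section Kernel

/-- **THE END-POINT FORM, EXPONENT `r ≤ 1`, WITH THE MARGIN**: a single layer `S ≤ 𝔪(c₂,s;δ)(·,y)` on a face `F ⊆ {u_ν = c}` read through a column
`K ≤ 𝔪(c₁,r;δ)(b,·)` (`0 < r ≤ 1`) anchored at a point `b` of height `≥ θL^k` above the face:
`Σ_{u∈F}K(u)S(u) ≤ 𝔪(c₁c₂(8d/δ)^{d−1}(ε^{d−1})^{−1}(θ^{r−1}(1+4d/δ)r₁/(1−r₁) + L^{s−1}(L^{s−1}−1)^{−1}), r+s−1; δ/2)(b,y)` — UNIFORM IN `k`: what the Hölder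
binder `hH` (`r = 1 − α`) of (2.5) for (1.16) on a box calls at ends one top block inside `□`. [cite: Balaban1983Higgs3, (1.16) p.414, (2.5) p.424, (2.11) p.426, p.433] -/
theorem face_sum_kernel_le_one_margin_le (hL : 1 < P.L) {k : ℕ} {δ : ℝ} (hδ : 0 < δ) (hδ1 : δ ≤ 1) {r s c₁ c₂ θ : ℝ}
    (hr0 : 0 < r) (hr1 : r ≤ 1) (hs : 1 < s) (hc₁ : 0 ≤ c₁) (hc₂ : 0 ≤ c₂) (hθ : 0 < θ)
    {F : Finset (HiggsLattice.Site P 0)} {ν : Fin P.d} {c : ZMod (P.sitesPerDir 0 ν)} (hF : ∀ u ∈ F, u ν = c)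
    (b y : HiggsLattice.Site P 0) (hh : θ * (P.L : ℝ) ^ k ≤ ((min (b ν - c).val (c - b ν).val : ℕ) : ℝ))
    (K S : HiggsLattice.Site P 0 → ℝ) (hK0 : ∀ u ∈ F, 0 ≤ K u) (hS0 : ∀ u ∈ F, 0 ≤ S u)
    (hK : ∀ u ∈ F, K u ≤ ∑ j ∈ Finset.range k, c₁ * P.mesh j ^ (r - (P.d : ℝ)) *
      Real.exp (-(δ * (P.mesh j)⁻¹ * (P.mesh 0 * (HiggsLattice.Site.tdist b u : ℝ)))))
    (hS : ∀ u ∈ F, S u ≤ ∑ j ∈ Finset.range k, c₂ * P.mesh j ^ (s - (P.d : ℝ)) *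
      Real.exp (-(δ * (P.mesh j)⁻¹ * (P.mesh 0 * (HiggsLattice.Site.tdist u y : ℝ))))) :
    ∑ u ∈ F, K u * S u
      ≤ ∑ j ∈ Finset.range k, (c₁ * c₂ * ((8 * P.d / δ) ^ (P.d - 1) * (P.mesh 0 ^ (P.d - 1))⁻¹ *
            (θ ^ (r - 1) * ((1 + 4 * P.d / δ) *
                (Real.exp (-(δ / 2 * θ * ((P.L : ℝ) - 1) / (2 * P.d))) / (1 - Real.exp (-(δ / 2 * θ * ((P.L : ℝ) - 1) / (2 * P.d))))))
              + (P.L : ℝ) ^ (s - 1) / ((P.L : ℝ) ^ (s - 1) - 1)))) *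
          P.mesh j ^ (r + s - 1 - (P.d : ℝ)) *
          Real.exp (-(δ / 2 * (P.mesh j)⁻¹ * (P.mesh 0 * (HiggsLattice.Site.tdist b y : ℝ)))) := by
  have h0 : ∑ u ∈ F, K u * S u ≤ ∑ u ∈ F,
      (∑ j ∈ Finset.range k, c₁ * P.mesh j ^ (r - (P.d : ℝ)) *
          Real.exp (-(δ * (P.mesh j)⁻¹ * (P.mesh 0 * (HiggsLattice.Site.tdist b u : ℝ))))) *
      (∑ j ∈ Finset.range k, c₂ * P.mesh j ^ (s - (P.d : ℝ)) *
          Real.exp (-(δ * (P.mesh j)⁻¹ * (P.mesh 0 * (HiggsLattice.Site.tdist u y : ℝ))))) :=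
    Finset.sum_le_sum fun u hu => mul_le_mul (hK u hu) (hS u hu) (hS0 u hu) ((hK0 u hu).trans (hK u hu))
  exact h0.trans (face_conv_majorant_le_one_margin_le (P := P) hL hδ hδ1 hr0 hr1 hs hc₁ hc₂ hθ hF b y hh)

end Kernel

end Literature.MathematicalPhysics.QuantumFieldTheory.Balaban1983to89.B3Op116FaceSumsSubOne

end
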